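import Summits.HodgeConjecture.HodgeConjecture.Theorems.MarkmanPartnerTransportPicardThreeK3SquaresQuotientDescent

/-!
# Route MarkmanPartnerTransport · crux `PicardThreeK3Squares` (stmt-HodgeConjecture-19652) —
# the TRANSPOSE of an algebraic similitude datum is again a datum (so `…QuotientDescent` runs both ways)

For marked projective K3 surfaces `(X, η, p, x)`, `(Z, η_Z, p_Z, x_Z)` and a datum `γ` for `X` from `Z` of
multiplier `m ≠ 0` (an algebraic class on `X ⊗ Z` acting as a rational, Hodge-type preserving map
`φ = [γ]_*` taking `T(Z)` onto `T(X)` with `(ηφa · ηφb) = m (η_Z a · η_Z b)`), the transposed class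
`ᵗγ = swap^*γ` on `Z ⊗ X` is a datum for `Z` from `X` of multiplier `c²/m`, `c = m·∫p_X/∫p_Z`: `ᵗφ = [ᵗγ]_*`
is algebraic (`transpose_mem_algebraicClasses`), rational (`isRationalClass_transpose`), Hodge-type
preserving (`isOfHodgeType_transpose`, `…QuotientDescent`), maps `T(X)` onto `T(Z)` (`ᵗφφ = c` on `T(Z)`)
and `m (η_Z ᵗφa · η_Z ᵗφb) = c² (ηa · ηb)` on `T(X)` (`φᵗφ = c` there).

* `datum_transpose` — the statement above; with `cycleInducedSector_of_datum` it gives the converse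
  transport `Sector[X] ⟹ Sector[Z]` (`cycleInducedSector_of_datum_symm`).

No definition, no sorry, no named fact; route-independent. Prover seat hodge-nonav-19652-p1 (gen 5),
`--supports stmt-HodgeConjecture-19652`.

References: B. Kahn, *Zeta and L-functions of varieties and motives*, §3.5.3 Lemma 3.48; M. Varesco,
Math. Z. 305 (2023) §2; W. Fulton, *Intersection theory*, §16.1.
-/

set_option linter.dupNamespace false

noncomputable section

namespace Summit.HodgeConjecture.HodgeConjecture.Theorems.MarkmanPartnerTransport.QuotientSimilitude

open scoped Manifold
open Module CategoryTheory MonoidalCategory CartesianMonoidalCategory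
open Literature.AlgebraicGeometry Literature.AlgebraicGeometry.Motives Literature.AlgebraicGeometry.HodgeTheory
open Literature.AlgebraicGeometry.Surfaces
open Literature.AlgebraicTopology.SingularHomology
open Summit.HodgeConjecture.HodgeConjecture.Theorems
open Summit.HodgeConjecture.HodgeConjecture.Theorems.NikulinTwinTransport
open Summit.HodgeConjecture.HodgeConjecture.Theorems.NikulinTwinTransport.SquareGlueFree
open Summit.HodgeConjecture.HodgeConjecture.Theorems.MarkmanPartnerTransport
open Summit.HodgeConjecture.HodgeConjecture.Theorems.MarkmanPartnerTransport.SimilitudeTranspose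

variable {S Z : SchemeOver ℂ}

/-- `MarkedK3[S, η, p, x]`: VERBATIM the `let MarkedK3 := …` binder of the route declaration
`PicardThreeK3Squares`. Local notation only. -/
local notation3 (prettyPrint := false) "MarkedK3[" S ", " η ", " p ", " x "]" =>
  (p ≠ 0 ∧ (IsIntegralClass p ∧
    (∀ q : complexBetti S (2 * 2), IsIntegralClass q → ∃ n : ℤ, q = n • p) ∧
    (∀ c : complexBetti S (2 * 1), IsIntegralClass c ↔ ∃ v : K3Index → ℤ, η c = fun i => (v i : ℂ)) ∧
    (∀ a b : complexBetti S (2 * 1),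
      cupProduct (rfl : 2 * 1 + 2 * 1 = 2 * 2) a b = k3Form (η a) (η b) • p) ∧
    IsOfHodgeType 2 S (2 * 1) 2 0 (LinearEquiv.symm η x) ∧
    (∀ τ : complexBetti S (2 * 1), IsOfHodgeType 2 S (2 * 1) 2 0 τ →
      ∃ t : ℂ, τ = t • LinearEquiv.symm η x)) ∧
    (k3Form x x = 0 ∧ 0 < (k3Form (star x) x).re ∧
      ∃ u : K3Index → ℤ, k3Form (fun i => (u i : ℂ)) x = 0 ∧ 0 < ∑ i, ∑ j, u i * k3Gram i j * u j))

/-- `Corr[μ, X, Y, hX, hY ; γ, y] = fst_* (snd^* y ∪ γ)` (`hX hY : IsSmoothProjective 2 _`). Local notation only. -/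
local notation3 (prettyPrint := false) "Corr[" μ ", " X ", " Y ", " hX ", " hY " ; " γ ", " y "]" =>
  complexGysin μ (IsSmoothProjective.tensor_holds hX hY) hX (SemiCartesianMonoidalCategory.fst X Y)
    (rfl : 2 * 1 + 2 * 2 + 2 * 2 = 2 * 1 + 2 * (2 + 2))
    (cupProduct (rfl : 2 * 1 + 2 * 2 = 2 * 1 + 2 * 2)
      (complexBetti.map (SemiCartesianMonoidalCategory.snd X Y) (2 * 1) y) γ)

/-- `Transp[X, Y ; γ] = swap^* γ`. Local notation only. -/
local notation3 (prettyPrint := false) "Transp[" X ", " Y " ; " γ "]" =>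
  complexBetti.map (CartesianMonoidalCategory.lift (SemiCartesianMonoidalCategory.snd Y X)
    (SemiCartesianMonoidalCategory.fst Y X)) (2 * 2) γ

/-- `Datum[X, Z, hX, hZ, η, ηZ ; γ, m]`: `γ` is an algebraic class on `X ⊗ Z` whose action `[γ]_*` is
rational, Hodge-type preserving, maps `T(Z)` onto `T(X)` and scales the forms there by `m` in the
markings. Local notation only. -/
local notation3 (prettyPrint := false) "Datum[" X ", " Z ", " hX ", " hZ ", " η ", " ηZ " ; " γ ", " m "]" =>
  (γ ∈ algebraicClasses (X ⊗ Z) 2 ∧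
    (∀ y, IsRationalClass y → IsRationalClass (Corr[complexOrientationFamily, X, Z, hX, hZ ; γ, y])) ∧
    (∀ (i j : ℕ) y, IsOfHodgeType 2 Z (2 * 1) i j y →
      IsOfHodgeType 2 X (2 * 1) i j (Corr[complexOrientationFamily, X, Z, hX, hZ ; γ, y])) ∧
    (∀ y ∈ transcendentalSubspace Z,
      Corr[complexOrientationFamily, X, Z, hX, hZ ; γ, y] ∈ transcendentalSubspace X) ∧
    (∀ z ∈ transcendentalSubspace X, ∃ y ∈ transcendentalSubspace Z,
      Corr[complexOrientationFamily, X, Z, hX, hZ ; γ, y] = z) ∧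
    (∀ a ∈ transcendentalSubspace Z, ∀ b ∈ transcendentalSubspace Z,
      k3Form (η (Corr[complexOrientationFamily, X, Z, hX, hZ ; γ, a]))
        (η (Corr[complexOrientationFamily, X, Z, hX, hZ ; γ, b])) = m * k3Form (ηZ a) (ηZ b)))

/-- `Sector[S, hS]`: the cycle-induced sector clause for `S` (complex orientations), VERBATIM the
hypothesis of `CycleInducedSector.hodgeConjectureFor_square_of_cycleInducedSector`. Local notation only. -/
local notation3 (prettyPrint := false) "Sector[" S ", " hS "]" =>
  (∀ (f : complexBetti S (2 * 1) →ₗ[ℂ] complexBetti S (2 * 1)),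
    (∀ y, IsRationalClass y → IsRationalClass (f y)) →
    (∀ (i j : ℕ) y, IsOfHodgeType 2 S (2 * 1) i j y → IsOfHodgeType 2 S (2 * 1) i j (f y)) →
    (∀ d ∈ algebraicClasses S 1, f d = 0) →
    (∀ y : complexBetti S (2 * 1), ∀ d ∈ algebraicClasses S 1,
      cupProduct (rfl : 2 * 1 + 2 * 1 = 2 * 2) (f y) d = 0) →
    ∃ g : complexBetti S (2 * 1) →ₗ[ℂ] complexBetti S (2 * 1),
      (∀ d ∈ algebraicClasses S 1, g d ∈ algebraicClasses S 1) ∧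
      (∃ γ ∈ algebraicClasses (S ⊗ S) 2, ∀ y : complexBetti S (2 * 1),
        g y = Corr[complexOrientationFamily, S, S, hS, hS ; γ, y]) ∧
      ∀ y : complexBetti S (2 * 1),
        (∀ d ∈ algebraicClasses S 1, cupProduct (rfl : 2 * 1 + 2 * 1 = 2 * 2) y d = 0) → f y = g y)

/-! ### The transposed datum -/

/-- **The transpose `ᵗγ` of a datum `γ` for `X` from `Z` (multiplier `m ≠ 0`) is a datum for `Z` from `X`
of multiplier `c²/m`, `c = m·∫p_X/∫p_Z`** (module docstring). [cite: Kahn2020, §3.5.3 Lemma 3.48]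
[cite: Varesco2023, §2 (p. 8)] -/
theorem datum_transpose (hS : IsK3Surface S)
    (η : complexBetti S (2 * 1) ≃ₗ[ℂ] (K3Index → ℂ)) (p : complexBetti S (2 * 2)) (x : K3Index → ℂ)
    (hM : MarkedK3[S, η, p, x]) (hZ : IsK3Surface Z)
    (ηZ : complexBetti Z (2 * 1) ≃ₗ[ℂ] (K3Index → ℂ)) (pZ : complexBetti Z (2 * 2)) (xZ : K3Index → ℂ)
    (hMZ : MarkedK3[Z, ηZ, pZ, xZ]) {m : ℂ} (hm : m ≠ 0) (γ : complexBetti (S ⊗ Z) (2 * 2))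
    (hD : Datum[S, Z, hS.1, hZ.1, η, ηZ ; γ, m]) :
    Datum[Z, S, hZ.1, hS.1, ηZ, η ; Transp[S, Z ; γ],
      ((m * traceC hS.1 p * (traceC hZ.1 pZ)⁻¹) ^ 2 / m)] := by
  classical
  have htyp := isOfHodgeType_transpose hS η p x hM hZ ηZ pZ xZ hMZ hm γ hD
  obtain ⟨hp₀, ⟨-, -, -, hηcup, -, -⟩, -⟩ := id hM
  obtain ⟨hpZ0, ⟨-, -, -, hηZcup, -, -⟩, -⟩ := id hMZ
  obtain ⟨hγalg, hφrat, hφtyp, hφT, hφonto, hφmul⟩ := hD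
  set φ : complexBetti Z (2 * 1) →ₗ[ℂ] complexBetti S (2 * 1) :=
    (complexGysin complexOrientationFamily (IsSmoothProjective.tensor_holds hS.1 hZ.1) hS.1
        (SemiCartesianMonoidalCategory.fst S Z) (rfl : 2 * 1 + 2 * 2 + 2 * 2 = 2 * 1 + 2 * (2 + 2))) ∘ₗ
      ((cupProduct (rfl : 2 * 1 + 2 * 2 = 2 * 1 + 2 * 2)).flip γ) ∘ₗ
      (complexBetti.map (SemiCartesianMonoidalCategory.snd S Z) (2 * 1)).hom with hφdef
  have hφ : ∀ y, φ y = Corr[complexOrientationFamily, S, Z, hS.1, hZ.1 ; γ, y] := fun y ↦ rfl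
  set φt : complexBetti S (2 * 1) →ₗ[ℂ] complexBetti Z (2 * 1) :=
    (complexGysin complexOrientationFamily (IsSmoothProjective.tensor_holds hZ.1 hS.1) hZ.1
        (SemiCartesianMonoidalCategory.fst Z S) (rfl : 2 * 1 + 2 * 2 + 2 * 2 = 2 * 1 + 2 * (2 + 2))) ∘ₗ
      ((cupProduct (rfl : 2 * 1 + 2 * 2 = 2 * 1 + 2 * 2)).flip (Transp[S, Z ; γ])) ∘ₗ
      (complexBetti.map (SemiCartesianMonoidalCategory.snd Z S) (2 * 1)).hom with hφtdef
  have hφt : ∀ w, φt w = Corr[complexOrientationFamily, Z, S, hZ.1, hS.1 ; Transp[S, Z ; γ], w] :=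
    fun w ↦ rfl
  have hφtyp' : ∀ y, IsOfHodgeType 2 Z (2 * 1) 1 1 y →
      IsOfHodgeType 2 S (2 * 1) 1 1 (Corr[complexOrientationFamily, S, Z, hS.1, hZ.1 ; γ, y]) :=
    fun y hy ↦ hφtyp 1 1 y hy
  set c : ℂ := m * traceC hS.1 p * (traceC hZ.1 pZ)⁻¹ with hcdef
  have hτS : traceC hS.1 p ≠ 0 := fun h ↦ hp₀ (eq_zero_of_traceC_eq_zero hS.1 h)
  have hτZ : traceC hZ.1 pZ ≠ 0 := fun h ↦ hpZ0 (eq_zero_of_traceC_eq_zero hZ.1 h)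
  have hc0 : c ≠ 0 := by
    rw [hcdef]; exact mul_ne_zero (mul_ne_zero hm hτS) (inv_ne_zero hτZ)
  have key : ∀ z ∈ transcendentalSubspace S, φ (φt z) = c • z := fun z hz ↦ by
    rw [hφt, hφ]
    exact comp_transpose_eq_smul hS.1 hZ.1 η p ηZ pZ hpZ0 hηcup hηZcup γ hφrat hφtyp' hφT hφonto hφmul hz
  have key' : ∀ y ∈ transcendentalSubspace Z, φt (φ y) = c • y := fun y hy ↦ by
    rw [hφt, hφ]
    exact transpose_comp_eq_smul hS.1 hZ.1 η p ηZ pZ hpZ0 hηcup hηZcup γ hφrat hφtyp' hφT hφmul hy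
  have hφtT : ∀ z ∈ transcendentalSubspace S, φt z ∈ transcendentalSubspace Z := fun z hz ↦ by
    rw [hφt]; exact transpose_mem_transcendentalSubspace hS.1 hZ.1 γ hφrat hφtyp' hz
  refine ⟨transpose_mem_algebraicClasses hS.1 hZ.1 hγalg,
    fun y hy ↦ isRationalClass_transpose hS.1 hZ.1 γ hφrat hy, htyp, fun z hz ↦ by rw [← hφt]; exact hφtT z hz,
    fun w hw ↦ ⟨c⁻¹ • φ w, Submodule.smul_mem _ _ (by rw [hφ]; exact hφT w hw), ?_⟩, fun a ha b hb ↦ ?_⟩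
  · rw [← hφt, map_smul, key' w hw, smul_smul, inv_mul_cancel₀ hc0, one_smul]
  · have h := hφmul _ (hφtT a ha) _ (hφtT b hb)
    rw [← hφ, ← hφ, key a ha, key b hb, map_smul, map_smul, k3Form_smul_left, k3Form_smul_right] at h
    have h3 : k3Form (ηZ (φt a)) (ηZ (φt b)) = c ^ 2 / m * k3Form (η a) (η b) := by
      rw [div_mul_eq_mul_div, eq_div_iff hm]
      linear_combination -h
    rw [← hφt, ← hφt]
    exact h3

/-- **The converse transport**: the sector clause for `X` implies the clause for `Z` (apply
`cycleInducedSector_of_datum` to the transposed datum). [cite: Varesco2023, §2 (p. 8)] -/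
theorem cycleInducedSector_of_datum_symm (hS : IsK3Surface S)
    (η : complexBetti S (2 * 1) ≃ₗ[ℂ] (K3Index → ℂ)) (p : complexBetti S (2 * 2)) (x : K3Index → ℂ)
    (hM : MarkedK3[S, η, p, x]) (hZ : IsK3Surface Z)
    (ηZ : complexBetti Z (2 * 1) ≃ₗ[ℂ] (K3Index → ℂ)) (pZ : complexBetti Z (2 * 2)) (xZ : K3Index → ℂ)
    (hMZ : MarkedK3[Z, ηZ, pZ, xZ]) {m : ℂ} (hm : m ≠ 0) (hmrat : ∃ q : ℚ, (q : ℂ) = m)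
    (γ : complexBetti (S ⊗ Z) (2 * 2)) (hD : Datum[S, Z, hS.1, hZ.1, η, ηZ ; γ, m])
    (hsec : Sector[S, hS.1]) : Sector[Z, hZ.1] := by
  obtain ⟨hp₀, ⟨hpint, -, -, -, -, -⟩, -⟩ := id hM
  obtain ⟨hpZ0, ⟨hpZint, -, -, -, -, -⟩, -⟩ := id hMZ
  have hτS : traceC hS.1 p ≠ 0 := fun h ↦ hp₀ (eq_zero_of_traceC_eq_zero hS.1 h)
  have hτZ : traceC hZ.1 pZ ≠ 0 := fun h ↦ hpZ0 (eq_zero_of_traceC_eq_zero hZ.1 h)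
  have hc0 : m * traceC hS.1 p * (traceC hZ.1 pZ)⁻¹ ≠ 0 :=
    mul_ne_zero (mul_ne_zero hm hτS) (inv_ne_zero hτZ)
  obtain ⟨q, hq⟩ := hmrat
  obtain ⟨p₀, hp₀eq⟩ := (isRationalClass_iff_mem_range_ofRatClass _).1 hpint.isRationalClass
  obtain ⟨pZ₀, hpZ₀eq⟩ := (isRationalClass_iff_mem_range_ofRatClass _).1 hpZint.isRationalClass
  refine cycleInducedSector_of_datum hZ ηZ pZ xZ hMZ hS η p x hM (div_ne_zero (pow_ne_zero 2 hc0) hm)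
    ⟨(q * trace hS.1 p₀ * (trace hZ.1 pZ₀)⁻¹) ^ 2 / q, ?_⟩ (Transp[S, Z ; γ])
    (datum_transpose hS η p x hM hZ ηZ pZ xZ hMZ hm γ hD) hsec
  rw [← hp₀eq, ← hpZ₀eq, traceC_ofRatClass, traceC_ofRatClass, ← hq]
  push_cast
  rfl

end Summit.HodgeConjecture.HodgeConjecture.Theorems.MarkmanPartnerTransport.QuotientSimilitude

end
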